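import Literature.Topology.FourManifolds.KhTriangleCross
import Literature.Topology.FourManifolds.KhHtpyEquiv
import HarnessLib

/-!
# Invariance of Khovanov homology under the third Reidemeister move `Ω3a`

Sibling file of `KhComplex.lean`, closing the programme of `KhTriangle*.lean`: for three
positive chords `x, y, z` of a Gauss diagram `G` in the configuration of
`PolyakMove.omega3a` (`x ≠ z`), such that every cube edge of `G` and of `G.braidMove x y z` is
a merge or a split (true whenever both are realised by knots),
`Kh^{i,j}(G) ≅ Kh^{i,j}(G.braidMove x y z)` (`nonempty_iso_khovanovHomology_omega3a`) and
`H^i(G; h, t) ≅ H^i(G.braidMove x y z; h, t)` over every Frobenius system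
(`nonempty_iso_frobeniusHomology_omega3a`).

Proof (Khovanov (2000), §5.4; Bar-Natan (2002), §4.4; Bar-Natan (2007), Lemma 4.2): the cochains
of each side retract by Gaussian elimination of its loop square onto its rest
(`LoopSq.loopMHtpy`, `KhLoopSquareElim.lean`); after rescaling by the gauge, the bijection
`restEquiv` identifies the two reduced complexes (`loopM_restEquiv`, `KhTriangleCross.lean`); two
retractions onto a common complex form a homotopy equivalence (`HtpyEquiv.ofRetractions`),
which is bigraded (`isGraded_loopMHtpy`, `homDegree_toG'`, `qDegree_toG'`) and therefore
induces isomorphisms on homology (`KhHtpyEquiv.lean`). No named fact is introduced.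

## References

* M. Khovanov, *A categorification of the Jones polynomial*, Duke Math. J. 101 (2000) 359–426,
  §5.4, Thm. 1. [cite: Khovanov2000, §5.4]
* D. Bar-Natan, *On Khovanov's categorification of the Jones polynomial*, Algebr. Geom. Topol. 2
  (2002) 337–370, §4.4. [cite: BarNatan2002, §4]
* D. Bar-Natan, *Fast Khovanov homology computations*, J. Knot Theory Ramifications 16 (2007),
  Lemma 4.2. [cite: BarNatan2007, Lemma 4.2]
-/

open CategoryTheory Function

noncomputable section

namespace Literature.Topology.FourManifolds

namespace GaussDiagram

open KhElim

section Omega3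

variable (G : GaussDiagram) {x y z : Fin G.n}
variable (hxz : x ≠ z) (ha : (G.overPos y : ℕ) = G.overPos x + 1) (hb : (G.overPos z : ℕ) = G.underPos x + 1)
  (hc : (G.underPos z : ℕ) = G.underPos y + 1) (hx : G.sign x = 1) (hy : G.sign y = 1) (hz : G.sign z = 1)
variable {R : Type} [CommRing R] (hR tR : R)
variable (hms : ∀ (τ : G.State) (k : Fin G.n), τ k = false → G.IsMergeAt τ k ∨ G.IsSplitAt τ k)
  (hms' : ∀ (τ : (G.braidMove x y z).State) (k : Fin (G.braidMove x y z).n), τ k = false →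
    (G.braidMove x y z).IsMergeAt τ k ∨ (G.braidMove x y z).IsSplitAt τ k)

/-- The condition `z = 1` is monotone along the cube. [folklore] -/
theorem hPm_tri : ∀ (σ : G.State) (j : Fin G.n), (G.triLoopSq hxz ha hb hc hx hy hz).P σ →
    (G.triLoopSq hxz ha hb hc hx hy hz).P (Function.update σ j true) := by
  intro σ j hσ
  show Function.update σ j true z = true
  by_cases hjz : j = z
  · rw [hjz, Function.update_self]
  · rw [Function.update_of_ne (Ne.symm hjz)]; exact hσ

/-- The condition `z = 1` is monotone along the cube of the rearrangement. [folklore] -/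
theorem hPm_tri' : ∀ (σ : (G.braidMove x y z).State) (j : Fin G.n), (G.triLoopSq' hxz ha hb hc hx hy hz).P σ →
    (G.triLoopSq' hxz ha hb hc hx hy hz).P (Function.update σ j true) := by
  intro σ j hσ
  show Function.update σ j true z = true
  rw [Function.update_apply]
  split_ifs
  · rfl
  · exact hσ

/-- **The retraction of `C(G)` onto the rest of the rearrangement**: Gaussian elimination of the
loop square of `G`, rescaling by the gauge, and the identification `restEquiv`.
[cite: Khovanov2000, §5.4] -/
def retractG : MHtpy (G.incidence R hR tR) ((G.triLoopSq' hxz ha hb hc hx hy hz).loopM hR tR) :=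
  ((G.triLoopSq hxz ha hb hc hx hy hz).loopMHtpy (G.sideA x) G.inT_sideA hR tR hms (G.hPm_tri hxz ha hb hc hx hy hz)).trans
    ((MHtpy.rescale ((G.triLoopSq hxz ha hb hc hx hy hz).loopM hR tR)
        (fun r ↦ (G.gauge x y z r.1.state : R)) (fun r ↦ by
          rw [← Int.cast_mul, G.gauge_mul_self]; exact Int.cast_one)).trans
      (MHtpy.ofEquiv (G.restEquiv hxz ha hb hc hx hy hz).symm
        (fun a b ↦ (G.gauge x y z a.1.state : R) * (G.triLoopSq hxz ha hb hc hx hy hz).loopM hR tR a b *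
          (G.gauge x y z b.1.state : R))
        ((G.triLoopSq' hxz ha hb hc hx hy hz).loopM hR tR) (fun a b ↦ by
          have key := G.loopM_restEquiv hxz ha hb hc hx hy hz hR tR
            ((G.restEquiv hxz ha hb hc hx hy hz).symm a) ((G.restEquiv hxz ha hb hc hx hy hz).symm b)
          rw [Equiv.apply_symm_apply, Equiv.apply_symm_apply] at key
          rw [key]; ring)))

/-- **The retraction of `C(G.braidMove x y z)` onto its rest.** [cite: Khovanov2000, §5.4] -/
def retractG' : MHtpy ((G.braidMove x y z).incidence R hR tR) ((G.triLoopSq' hxz ha hb hc hx hy hz).loopM hR tR) :=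
  (G.triLoopSq' hxz ha hb hc hx hy hz).loopMHtpy (G.sideA x) G.inT_sideA hR tR hms' (G.hPm_tri' hxz ha hb hc hx hy hz)

/-- **The homotopy equivalence of the third move** `C(G) ≃ C(G.braidMove x y z)`.
[cite: Khovanov2000, §5.4] -/
def omega3Equiv : HtpyEquiv R G (G.braidMove x y z) hR tR :=
  HtpyEquiv.ofRetractions (G.retractG hxz ha hb hc hx hy hz hR tR hms) (G.retractG' hxz ha hb hc hx hy hz hR tR hms')

/-! ### Gradings -/

/-- **The retraction of `C(G)` onto the rest of the rearrangement is graded** for every pair of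
admissible degree maps corresponding under `toG'`. [folklore] -/
theorem isGraded_retractG {d : G.EnhancedState → ℤ × ℤ} {d' : (G.braidMove x y z).EnhancedState → ℤ × ℤ}
    (hd : LoopSq.AdmissibleDeg hR tR d)
    (hdd' : ∀ (t : G.EnhancedState) (h), d' (G.toG' hxz ha hb hc hx hy hz t h) = d t) :
    (G.retractG hxz ha hb hc hx hy hz hR tR hms).IsGraded d (fun a : (G.triLoopSq' hxz ha hb hc hx hy hz).XR ↦ d' a.1) := by
  unfold retractG
  refine MHtpy.IsGraded.trans ((G.triLoopSq hxz ha hb hc hx hy hz).isGraded_loopMHtpy (G.sideA x) G.inT_sideA hms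
    (G.hPm_tri hxz ha hb hc hx hy hz) hd) ?_
  refine MHtpy.IsGraded.trans (MHtpy.IsGraded.rescale _ _ _ _) ?_
  refine MHtpy.IsGraded.ofEquiv _ _ _ _ (fun a ↦ ?_)
  -- `d (toG a) = d' a` through `a = toG' (toG a)`
  conv_rhs => rw [← (G.restEquiv hxz ha hb hc hx hy hz).apply_symm_apply a]
  rw [restEquiv_apply, hdd']

/-- **The retraction of `C(G.braidMove x y z)` onto its rest is graded.** [folklore] -/
theorem isGraded_retractG' {d' : (G.braidMove x y z).EnhancedState → ℤ × ℤ} (hd' : LoopSq.AdmissibleDeg hR tR d') :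
    (G.retractG' hxz ha hb hc hx hy hz hR tR hms').IsGraded d' (fun a : (G.triLoopSq' hxz ha hb hc hx hy hz).XR ↦ d' a.1) :=
  (G.triLoopSq' hxz ha hb hc hx hy hz).isGraded_loopMHtpy (G.sideA x) G.inT_sideA hms' (G.hPm_tri' hxz ha hb hc hx hy hz) hd'

/-! ### The isomorphisms -/

include hxz ha hb hc hx hy hz hms hms' in
/-- **Invariance of the homology over the universal Frobenius system under the third Reidemeister
move `Ω3a`**, for diagrams all of whose cube edges are merges or splits:
`H^i(G; h, t) ≅ H^i(G.braidMove x y z; h, t)`. Khovanov (2000), §5.4 (with Khovanov (2006) for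
general `(h, t)`); Bar-Natan (2002), §4.4. [cite: Khovanov2000, §5.4] -/
theorem nonempty_iso_frobeniusHomology_omega3a (i : ℤ) :
    Nonempty (G.frobeniusHomology R hR tR i ≅ (G.braidMove x y z).frobeniusHomology R hR tR i) := by
  have h1 := G.isGraded_retractG hxz ha hb hc hx hy hz hR tR hms (d' := fun s ↦ ((homDegree s : ℤ), (0 : ℤ)))
    (LoopSq.admissibleDeg_homDegree hR tR) (fun t h ↦ by simp only [G.homDegree_toG' hxz ha hb hc hx hy hz])
  have h2 := G.isGraded_retractG' hxz ha hb hc hx hy hz hR tR hms' (LoopSq.admissibleDeg_homDegree hR tR)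
  set D := G.omega3Equiv hxz ha hb hc hx hy hz hR tR hms hms' with hD
  have gF : Graded (fun s : G.EnhancedState ↦ ((homDegree s : ℤ), (0 : ℤ)))
      (fun s : (G.braidMove x y z).EnhancedState ↦ ((homDegree s : ℤ), (0 : ℤ))) 0 D.F := by
    rw [hD, omega3Equiv, HtpyEquiv.ofRetractions_F]; simpa using h1.B.comp h2.F
  have gB : Graded (fun s : (G.braidMove x y z).EnhancedState ↦ ((homDegree s : ℤ), (0 : ℤ)))
      (fun s : G.EnhancedState ↦ ((homDegree s : ℤ), (0 : ℤ))) 0 D.B := by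
    rw [hD, omega3Equiv, HtpyEquiv.ofRetractions_B]; simpa using h2.B.comp h1.F
  have gHG : Graded (fun s : G.EnhancedState ↦ ((homDegree s : ℤ), (0 : ℤ)))
      (fun s : G.EnhancedState ↦ ((homDegree s : ℤ), (0 : ℤ))) (-1, 0) D.HG := by
    rw [hD, omega3Equiv, HtpyEquiv.ofRetractions_HG]; exact h1.H
  have gHK : Graded (fun s : (G.braidMove x y z).EnhancedState ↦ ((homDegree s : ℤ), (0 : ℤ)))
      (fun s : (G.braidMove x y z).EnhancedState ↦ ((homDegree s : ℤ), (0 : ℤ))) (-1, 0) D.HK := by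
    rw [hD, omega3Equiv, HtpyEquiv.ofRetractions_HK]; exact h2.H
  refine D.nonempty_iso_frobeniusHomology ?_ ?_ ?_ ?_ i
  · intro k w hw s hs
    exact gF.apply_eq_zero_fst (i := k) (fun t ht ↦ hw t (by simpa using ht)) (by simpa using hs)
  · intro k v hv s hs
    exact gB.apply_eq_zero_fst (i := k) (fun t ht ↦ hv t (by simpa using ht)) (by simpa using hs)
  · intro k w hw s hs
    refine gHG.apply_eq_zero_fst (i := k) (fun t ht ↦ hw t (by simpa using ht)) ?_
    simp only [ne_eq]; intro h; exact hs (by omega)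
  · intro k v hv s hs
    refine gHK.apply_eq_zero_fst (i := k) (fun t ht ↦ hv t (by simpa using ht)) ?_
    simp only [ne_eq]; intro h; exact hs (by omega)

include hxz ha hb hc hx hy hz hms hms' in
/-- **Invariance of Khovanov homology under the third Reidemeister move `Ω3a`**, for diagrams
all of whose cube edges are merges or splits: `Kh^{i,j}(G) ≅ Kh^{i,j}(G.braidMove x y z)`.
Khovanov (2000), §5.4, Thm. 1; Bar-Natan (2002), §4.4. [cite: Khovanov2000, §5.4] -/
theorem nonempty_iso_khovanovHomology_omega3a (i j : ℤ) :
    Nonempty (G.khovanovHomology i j ≅ (G.braidMove x y z).khovanovHomology i j) := by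
  have h1 := G.isGraded_retractG hxz ha hb hc hx hy hz (0 : ℤ) 0 hms (d' := fun s ↦ (homDegree s, qDegree s))
    LoopSq.admissibleDeg_bideg (fun t h ↦ by
      simp only [G.homDegree_toG' hxz ha hb hc hx hy hz, G.qDegree_toG' hxz ha hb hc hx hy hz])
  have h2 := G.isGraded_retractG' hxz ha hb hc hx hy hz (0 : ℤ) 0 hms' LoopSq.admissibleDeg_bideg
  set D := G.omega3Equiv hxz ha hb hc hx hy hz (0 : ℤ) 0 hms hms' with hD
  have gF : Graded (fun s : G.EnhancedState ↦ (homDegree s, qDegree s))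
      (fun s : (G.braidMove x y z).EnhancedState ↦ (homDegree s, qDegree s)) 0 D.F := by
    rw [hD, omega3Equiv, HtpyEquiv.ofRetractions_F]; simpa using h1.B.comp h2.F
  have gB : Graded (fun s : (G.braidMove x y z).EnhancedState ↦ (homDegree s, qDegree s))
      (fun s : G.EnhancedState ↦ (homDegree s, qDegree s)) 0 D.B := by
    rw [hD, omega3Equiv, HtpyEquiv.ofRetractions_B]; simpa using h2.B.comp h1.F
  have gHG : Graded (fun s : G.EnhancedState ↦ (homDegree s, qDegree s))
      (fun s : G.EnhancedState ↦ (homDegree s, qDegree s)) (-1, 0) D.HG := by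
    rw [hD, omega3Equiv, HtpyEquiv.ofRetractions_HG]; exact h1.H
  have gHK : Graded (fun s : (G.braidMove x y z).EnhancedState ↦ (homDegree s, qDegree s))
      (fun s : (G.braidMove x y z).EnhancedState ↦ (homDegree s, qDegree s)) (-1, 0) D.HK := by
    rw [hD, omega3Equiv, HtpyEquiv.ofRetractions_HK]; exact h2.H
  refine D.nonempty_iso_khovanovHomology ?_ ?_ ?_ ?_ i j
  · intro k l w hw s hs
    exact gF.apply_eq_zero (g := (k, l)) (fun t ht ↦ hw t (by simpa [Prod.ext_iff] using ht))
      (by simpa [Prod.ext_iff] using hs)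
  · intro k l v hv s hs
    exact gB.apply_eq_zero (g := (k, l)) (fun t ht ↦ hv t (by simpa [Prod.ext_iff] using ht))
      (by simpa [Prod.ext_iff] using hs)
  · intro k l w hw s hs
    refine gHG.apply_eq_zero (g := (k, l)) (fun t ht ↦ hw t (by simpa [Prod.ext_iff] using ht)) ?_
    simp only [ne_eq, Prod.mk_add_mk, add_zero, Prod.ext_iff, not_and]
    intro h
    exact (hs ⟨by omega, ·⟩)
  · intro k l v hv s hs
    refine gHK.apply_eq_zero (g := (k, l)) (fun t ht ↦ hv t (by simpa [Prod.ext_iff] using ht)) ?_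
    simp only [ne_eq, Prod.mk_add_mk, add_zero, Prod.ext_iff, not_and]
    intro h
    exact (hs ⟨by omega, ·⟩)

include hxz ha hb hc hx hy hz in
/-- **Invariance of Khovanov homology under the third Reidemeister move `Ω3a`, for diagrams
realised by knots** (both sides): `Kh^{i,j}(G) ≅ Kh^{i,j}(G.braidMove x y z)`; the merge-or-split
hypotheses are the proved fact `isMergeAt_or_isSplitAt_of_hasGaussDiagram`. Khovanov (2000),
§5.4, Thm. 1. [cite: Khovanov2000, Thm. 1] -/
theorem nonempty_iso_khovanovHomology_omega3a_of_hasGaussDiagram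
    (hK : ∃ K : Knot, K.HasGaussDiagram G) (hK' : ∃ K : Knot, K.HasGaussDiagram (G.braidMove x y z)) (i j : ℤ) :
    Nonempty (G.khovanovHomology i j ≅ (G.braidMove x y z).khovanovHomology i j) :=
  G.nonempty_iso_khovanovHomology_omega3a hxz ha hb hc hx hy hz
    (fun _ _ hτ ↦ isMergeAt_or_isSplitAt_of_hasGaussDiagram_holds hK hτ)
    (fun _ _ hτ ↦ isMergeAt_or_isSplitAt_of_hasGaussDiagram_holds hK' hτ) i j

include hxz ha hb hc hx hy hz in
/-- **Invariance of the homology over the universal Frobenius system under `Ω3a`, for diagrams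
realised by knots.** [cite: Khovanov2000, Thm. 1] -/
theorem nonempty_iso_frobeniusHomology_omega3a_of_hasGaussDiagram
    (hK : ∃ K : Knot, K.HasGaussDiagram G) (hK' : ∃ K : Knot, K.HasGaussDiagram (G.braidMove x y z)) (i : ℤ) :
    Nonempty (G.frobeniusHomology R hR tR i ≅ (G.braidMove x y z).frobeniusHomology R hR tR i) :=
  G.nonempty_iso_frobeniusHomology_omega3a hxz ha hb hc hx hy hz hR tR
    (fun _ _ hτ ↦ isMergeAt_or_isSplitAt_of_hasGaussDiagram_holds hK hτ)
    (fun _ _ hτ ↦ isMergeAt_or_isSplitAt_of_hasGaussDiagram_holds hK' hτ) i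

end Omega3

end GaussDiagram

end Literature.Topology.FourManifolds
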